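import Summits.QuantumFields.YangMills.Theorems.CovariantDischargeAvgPlaqFluxLinear
import HarnessLib

/-!
# Crux `HistoryTailL` (stmt-QuantumFields-19936) — THE `j`-FOLD (0.4) AVERAGE IS FLUX-LINEAR: the plaquette variable of `Ū^{(j)}` is
# `L^j` times the circulation of Bałaban's straight-line `j`-fold average `Q_j(U − 1)` ([Balaban1984PropagatorsI] (1.18)), to second order
# (brick (M2) of the LOCATE «B3» for the capped sweep stub `stub_sandwichSweepGapCapped` of the ledger skeleton v5
# `Cruxes/HistoryTailL/Lines/sandwich_discharge.lean`; text-independent of that stub — a property of the averaging of record alone)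

Cell `ym3-torus` (YM ladder rung R3 = continuum SU(2) Yang–Mills on the three-torus; NOT the Clay problem), width seat `ym-ust-19936-w5` gen 13.

THE STATEMENT (§2 `iter_plaqHol_flux_linear`).  Let `W` be an `SU(N)` lattice gauge field on `T^{(0)}` in the flat small-field chart `‖W_b − 1‖ ≤ s₀` (all bonds),
`W^{(i)} := Ū^{(i)}[W]` the `i`-fold (0.4) average of record (`Averaging.iter (blockAvg expMeanLogSU)`), `Y₀ := W − 1`, and let `s, E : ℕ → ℝ` be any
RECURSION MAJORANTS: `s 0 ≥ s₀`, `3ℓ·s_i + 81(ℓ s_i)² ≤ s_{i+1}`, `13 s₀² ≤ E 0`, `L²·E_i + 1377(ℓ s_i)² + 13L²s_i² ≤ E_{i+1}`, under the one-step guards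
`16ℓ s_i ≤ 1` (`i ≤ j`), `2ℓ s_i < δ_N` (`i < j`) (`ℓ = (d+2)L`), standing range `j ≤ m + K`.  Then
  (A) every bond of `W^{(j)}` is within `s_j` of `1`, and
  (B) for every plaquette `p` of `T^{(j)}`:  `‖(W^{(j)}(∂p) − 1) − L^j·(Q_jY₀)(∂p)‖ ≤ E_j`,
where `(Q_jY₀)(∂p) = Q_jY₀(c₁) + Q_jY₀(c₂) − Q_jY₀(c₃) − Q_jY₀(c₄)` is the circulation of the straight-line `j`-fold block average `Q_j = bondAvgIter j`
(`LatticeFieldCalculus`, [Balaban1984PropagatorsI] (1.18) / [BalabanImbrieJaffe1985] (2.13)) around `p` — by the abelian lattice Stokes theorem, `L^j·(Q_jY₀)(∂p)` IS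
`(L^j)²` times the uniform mean of the fine circulations over the `(L^j)^d·(L^j)²` plaquettes of the translated-square family (the weights `w^{(j)}` of px8's B3 text;
cf. ✓`PoincareLipschitzLinAvgCurlClosedForm` for the linear model).  With geometric majorants `s_i ≍ (4ℓ)^i s₀`, `E_j ≲ j·C·L^{2j}·(4ℓ)^{2j}·s₀²` — second order
in `s₀`, consumable under the severity cap of the sweep stub (LOCATE «B3» §2 arithmetic).

THE PROOF.  Induction on `j`; the step is (M1) ✓`CovariantDischargeAvgPlaqFluxLinear.norm_plaqHol_avgFun_sub_one_sub_fluxes_le` (the coarse plaquette of ONE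
average = `L·L^{−(d+1)}·Σ` fine circulations `+ O(1377(ℓs)²)`) at level `i`, plus: a fine circulation of `Y_i = W^{(i)} − 1` is the plaquette deviation of `W^{(i)}`
to `O(13s_i²)` (✓`norm_plaqHol_sub_one_sub_circulation_le`), the induction hypothesis at each of the `L^d·L²` fine plaquettes, the weighted triple sum has norm
`≤ L²·(bound)` (§1), and the EXACT recursion of the linear term `L^{i+1}(Q_{i+1}Y₀)(∂p′) = L·L^{−(d+1)}·Σ_{r,s,t} L^i(Q_iY₀)(∂□_{rst})` (§1 `psi_succ`:
✓`LinAvgFluxExact.sum_bondAvg_plaq` + ✓`rect_stokes`).  Link smallness propagates by ✓`norm_avgFun_sub_one_sub_linAvg_le` + ✓`norm_linAvg_le`.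

WHAT THIS IS NOT.  Global flat chart at level 0 and no re-gauging between levels (so `s_i` grows like `(3ℓ)^i`; the factorised step of
✓`Prop8ChartOneStep.norm_conj_emlAvgU_sub_one_le` would give `L^i` at the price of conjugations — a refinement, not needed for the capped regime); the `SU(2)`
reading `⟪v, imVec(su2Quat ·)⟫` ((M3)) and the localisation to a ball (axial gauge + `Averaging.local_dep`) are the consumer's; nothing of the capped sweep stub,
`HistoryTailL` or the rung is proved.  YM₃ on T³ is rung R3, NOT the Clay problem.

References: T. Bałaban, CMP **98** (1985) 17–51 [Balaban1985Averaging] (Prop. 1 (51) p.26, Prop. 3 (122)–(125) p.36, Prop. 4 (134)–(135) p.38); CMP **95** (1984)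
17–40 [Balaban1984PropagatorsI] ((1.9)–(1.11) p.19, (1.18) p.20); CMP **109** (1987) 249–301 [Balaban1987RG1] ((0.4), (0.11) p.253).
-/

noncomputable section

open scoped BigOperators Matrix.Norms.L2Operator

namespace Summit.QuantumFields.YangMills.Theorems.CovariantDischargeAvgPlaqFluxLinearIter

open Literature.MathematicalPhysics.QuantumFieldTheory.Balaban1983to89
open T4Continuum BlockAveraging BlockAveragingEMLLinearised LatticeFieldCalculus ExpMeanLog
open Summit.QuantumFields.YangMills.Theorems.LinAvgFluxExact (sum_bondAvg_plaq rect_stokes)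
open B5Eq118OneStroke (iterBlock bondAvgIter_eq_blockSum sum_iterBlock_runSite)
open Summit.QuantumFields.YangMills.Theorems.CovariantDischargeAvgPlaqFluxLinear
  (norm_linAvg_le norm_plaqHol_sub_one_sub_circulation_le norm_plaqHol_avgFun_sub_one_sub_fluxes_le)

variable {n : Type*} [Fintype n] [DecidableEq n] [Nonempty n] {P : Params}

/-! ## §1 Letters: the weighted triple sum, one more averaging, the exact recursion of the linear term -/

section Letters

omit [Nonempty n] in
/-- THE WEIGHTED TRIPLE SUM (the form used): `‖L·L^{−(d+1)}·Σ_{r : Fin d → Fin L} Σ_{s<L} Σ_{t<L} g(r,s,t)‖ ≤ L²·B` when every term has norm `≤ B`.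
[cite: Balaban1985Averaging, Prop. 1 (51) p.26] -/
theorem norm_weighted_sum_le (g : (Fin P.d → Fin P.L) → ℕ → ℕ → Matrix n n ℂ) {B : ℝ}
    (hg : ∀ r, ∀ s ∈ Finset.range P.L, ∀ t ∈ Finset.range P.L, ‖g r s t‖ ≤ B) :
    ‖((P.L : ℕ) : ℂ) • ((((P.L : ℝ) ^ (P.d + 1))⁻¹) • ∑ r : Fin P.d → Fin P.L, ∑ s ∈ Finset.range P.L, ∑ t ∈ Finset.range P.L, g r s t)‖ ≤
      (P.L : ℝ) ^ 2 * B := by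
  have hL0 : (0 : ℝ) < P.L := Nat.cast_pos.mpr P.L_pos
  have hLd : (0 : ℝ) < (P.L : ℝ) ^ (P.d + 1) := by positivity
  have hsum : ‖∑ r : Fin P.d → Fin P.L, ∑ s ∈ Finset.range P.L, ∑ t ∈ Finset.range P.L, g r s t‖ ≤
      (P.L : ℝ) ^ P.d * ((P.L : ℝ) * ((P.L : ℝ) * B)) := by
    refine (norm_sum_le _ _).trans ?_
    have h1 : ∀ r : Fin P.d → Fin P.L, ‖∑ s ∈ Finset.range P.L, ∑ t ∈ Finset.range P.L, g r s t‖ ≤ (P.L : ℝ) * ((P.L : ℝ) * B) := by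
      intro r
      refine (norm_sum_le _ _).trans ?_
      have h2 : ∀ s ∈ Finset.range P.L, ‖∑ t ∈ Finset.range P.L, g r s t‖ ≤ (P.L : ℝ) * B := by
        intro s hs
        refine (norm_sum_le _ _).trans ?_
        have := Finset.sum_le_sum (s := Finset.range P.L) fun t ht => hg r s hs t ht
        refine this.trans ?_
        rw [Finset.sum_const, Finset.card_range, nsmul_eq_mul]
      refine (Finset.sum_le_sum h2).trans ?_
      rw [Finset.sum_const, Finset.card_range, nsmul_eq_mul]
    refine (Finset.sum_le_sum fun r _ => h1 r).trans ?_
    rw [Finset.sum_const, Finset.card_univ, Fintype.card_fun, Fintype.card_fin, Fintype.card_fin, nsmul_eq_mul]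
    push_cast
    rfl
  rw [norm_smul, norm_smul, norm_inv, Complex.norm_natCast, Real.norm_eq_abs, abs_of_pos hLd]
  calc (P.L : ℝ) * (((P.L : ℝ) ^ (P.d + 1))⁻¹ * ‖_‖) ≤ (P.L : ℝ) * (((P.L : ℝ) ^ (P.d + 1))⁻¹ * ((P.L : ℝ) ^ P.d * ((P.L : ℝ) * ((P.L : ℝ) * B)))) :=
        mul_le_mul_of_nonneg_left (mul_le_mul_of_nonneg_left hsum (by positivity)) hL0.le
    _ = (P.L : ℝ) ^ 2 * B := by field_simp; ring

/-- One more (0.4) averaging: `Ū^{(i+1)}[W] = avgFun ℰ (Ū^{(i)}[W])`. [cite: Balaban1987RG1, (0.11) p.253] -/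
theorem iter_succ_eq (ℰ : LoopAverage (Matrix.specialUnitaryGroup n ℂ)) (i : ℕ) (W : GaugeField P 0 (Matrix.specialUnitaryGroup n ℂ)) :
    Averaging.iter (fun i => BlockAveraging.blockAvg (P := P) (j := i) ℰ) (i + 1) W =
      avgFun ℰ (Averaging.iter (fun i => BlockAveraging.blockAvg (P := P) (j := i) ℰ) i W) := rfl

omit [Fintype n] [DecidableEq n] [Nonempty n] in
/-- **THE EXACT RECURSION OF THE LINEAR TERM**: `L^{i+1}·(Q_{i+1}A)(∂p′) = L·L^{−(d+1)}·Σ_{r,s,t} L^i·(Q_iA)(∂□(blockSite y r + se_μ + te_ν))` — one straight-line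
block average around a coarse plaquette is the block sum of the `L × L` rectangle circulations (✓`sum_bondAvg_plaq`), each the sum of its `L²` unit circulations
(✓`rect_stokes`). [cite: Balaban1984PropagatorsI, (1.9)-(1.11) p.19 and (1.18) p.20] -/
theorem psi_succ {i : ℕ} (hi : i + 1 ≤ P.m + P.K) (A : VecField P 0 (Matrix n n ℂ)) (p' : Plaq P (i + 1)) :
    ((P.L : ℝ) ^ (i + 1)) • (bondAvgIter (i + 1) A ⟨p'.src, p'.μ⟩ + bondAvgIter (i + 1) A ⟨p'.src.shift p'.μ, p'.ν⟩ -
        bondAvgIter (i + 1) A ⟨p'.src.shift p'.ν, p'.μ⟩ - bondAvgIter (i + 1) A ⟨p'.src, p'.ν⟩) =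
      ((P.L : ℕ) : ℂ) • ((((P.L : ℝ) ^ (P.d + 1))⁻¹) • ∑ r : Fin P.d → Fin P.L, ∑ s ∈ Finset.range P.L, ∑ t ∈ Finset.range P.L,
        ((P.L : ℝ) ^ i) • (bondAvgIter i A ⟨runSite (runSite (Site.blockSite p'.src r) p'.μ s) p'.ν t, p'.μ⟩ +
          bondAvgIter i A ⟨runSite (runSite (runSite (Site.blockSite p'.src r) p'.μ s) p'.ν t) p'.μ 1, p'.ν⟩ -
          bondAvgIter i A ⟨runSite (runSite (runSite (Site.blockSite p'.src r) p'.μ s) p'.ν t) p'.ν 1, p'.μ⟩ -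
          bondAvgIter i A ⟨runSite (runSite (Site.blockSite p'.src r) p'.μ s) p'.ν t, p'.ν⟩)) := by
  have hstep : bondAvgIter (i + 1) A = bondAvg (bondAvgIter i A) := rfl
  rw [hstep, sum_bondAvg_plaq hi (bondAvgIter i A) p'.src p'.μ p'.ν]
  simp_rw [rect_stokes (bondAvgIter i A) _ p'.μ p'.ν P.L P.L]
  simp_rw [← Finset.smul_sum]
  rw [Nat.cast_smul_eq_nsmul ℂ, ← Nat.cast_smul_eq_nsmul ℝ, smul_smul, smul_smul, smul_smul]
  congr 1
  ring

end Letters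

/-! ## §2 The `j`-fold average is flux-linear to second order -/

section Main

/-- ★★★ **THE `j`-FOLD (0.4) AVERAGE IS FLUX-LINEAR TO SECOND ORDER.**  `W` an `SU(N)` field on `T^{(0)}` with `‖W_b − 1‖ ≤ s 0` on every bond; `s, E` recursion
majorants (`3ℓs_i + 81(ℓs_i)² ≤ s_{i+1}`, `13(s 0)² ≤ E 0`, `L²E_i + 1377(ℓs_i)² + 13L²s_i² ≤ E_{i+1}`) under the guards `16ℓs_i ≤ 1` (`i ≤ j`), `2ℓs_i < δ_N`
(`i < j`), `j ≤ m + K`.  Then (A) `‖Ū^{(j)}[W](c) − 1‖ ≤ s_j` for every bond `c` of `T^{(j)}`, and (B) for every plaquette `p` of `T^{(j)}`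
`‖(Ū^{(j)}[W](∂p) − 1) − L^j·((Q_j(W−1))(c₁) + (Q_j(W−1))(c₂) − (Q_j(W−1))(c₃) − (Q_j(W−1))(c₄))‖ ≤ E_j` (`Q_j = bondAvgIter j`, `c₁…c₄` the bonds of `p` in the
order of `plaqHol`): the averaged plaquette variable is, to second order, `L^j` times the circulation of the straight-line `j`-fold average of the fine bond variables
— `(L^j)²` times the mean fine flux over the translated-square family.
[cite: Balaban1985Averaging, Prop. 1 (51) p.26 and Prop. 4 (134)-(135) p.38; Balaban1984PropagatorsI, (1.18) p.20; Balaban1987RG1, (0.11) p.253] -/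
theorem iter_plaqHol_flux_linear : ∀ (j : ℕ), j ≤ P.m + P.K → ∀ (W : GaugeField P 0 (Matrix.specialUnitaryGroup n ℂ)) (s E : ℕ → ℝ),
    (∀ i, 0 ≤ s i) →
    (∀ b, ‖((W b : Matrix.specialUnitaryGroup n ℂ) : Matrix n n ℂ) - 1‖ ≤ s 0) →
    (∀ i, i ≤ j → 16 * ((((P.d + 2) * P.L : ℕ) : ℝ) * s i) ≤ 1) →
    (∀ i, i < j → 2 * ((((P.d + 2) * P.L : ℕ) : ℝ) * s i) < deltaSU n) →
    (∀ i, i < j → 3 * ((((P.d + 2) * P.L : ℕ) : ℝ) * s i) + 81 * ((((P.d + 2) * P.L : ℕ) : ℝ) * s i) ^ 2 ≤ s (i + 1)) →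
    (13 * s 0 ^ 2 ≤ E 0) →
    (∀ i, i < j → (P.L : ℝ) ^ 2 * E i + (1377 * ((((P.d + 2) * P.L : ℕ) : ℝ) * s i) ^ 2 + (P.L : ℝ) ^ 2 * (13 * s i ^ 2)) ≤ E (i + 1)) →
    (∀ c : PBond P j, ‖((Averaging.iter (fun i => BlockAveraging.blockAvg (P := P) (j := i) (expMeanLogSU (n := n))) j W c :
        Matrix.specialUnitaryGroup n ℂ) : Matrix n n ℂ) - 1‖ ≤ s j) ∧
    ∀ p : Plaq P j,
      ‖((GaugeField.plaqHol (Averaging.iter (fun i => BlockAveraging.blockAvg (P := P) (j := i) (expMeanLogSU (n := n))) j W) p :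
            Matrix.specialUnitaryGroup n ℂ) : Matrix n n ℂ) - 1 -
          ((P.L : ℝ) ^ j) • (bondAvgIter j (fun b => ((W b : Matrix.specialUnitaryGroup n ℂ) : Matrix n n ℂ) - 1) ⟨p.src, p.μ⟩ +
            bondAvgIter j (fun b => ((W b : Matrix.specialUnitaryGroup n ℂ) : Matrix n n ℂ) - 1) ⟨p.src.shift p.μ, p.ν⟩ -
            bondAvgIter j (fun b => ((W b : Matrix.specialUnitaryGroup n ℂ) : Matrix n n ℂ) - 1) ⟨p.src.shift p.ν, p.μ⟩ -
            bondAvgIter j (fun b => ((W b : Matrix.specialUnitaryGroup n ℂ) : Matrix n n ℂ) - 1) ⟨p.src, p.ν⟩)‖ ≤ E j := by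
  intro j
  induction j with
  | zero =>
    intro _ W s E hs0' hW h16 _ _ hE0 _
    refine ⟨fun c => by simpa [Averaging.iter] using hW c, fun p => ?_⟩
    have hℓ1 : (1 : ℝ) ≤ (((P.d + 2) * P.L : ℕ) : ℝ) := by
      have : 1 ≤ (P.d + 2) * P.L := Nat.le_mul_of_pos_left _ (by omega) |>.trans' (by have := P.L_pos; nlinarith [P.L_pos])
      exact_mod_cast this
    have hs1 : s 0 ≤ 1 := by
      have h := h16 0 le_rfl
      nlinarith [hs0' 0]
    have h := norm_plaqHol_sub_one_sub_circulation_le W (hs0' 0) hs1 hW p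
    simpa [Averaging.iter, bondAvgIter] using h.trans hE0
  | succ i ih =>
    intro hj W s E hs0' hW h16 hN hsrec hE0 hErec
    -- the induction hypothesis at level `i`
    obtain ⟨hA, hB⟩ := ih (by omega) W s E hs0' hW (fun i' hi' => h16 i' (by omega)) (fun i' hi' => hN i' (by omega))
      (fun i' hi' => hsrec i' (by omega)) hE0 (fun i' hi' => hErec i' (by omega))
    -- letters at level `i`
    set ℓ : ℝ := (((P.d + 2) * P.L : ℕ) : ℝ) with hℓ
    set Wi : GaugeField P i (Matrix.specialUnitaryGroup n ℂ) :=
      Averaging.iter (fun i => BlockAveraging.blockAvg (P := P) (j := i) (expMeanLogSU (n := n))) i W with hWi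
    set Yi : PBond P i → Matrix n n ℂ := fun c => ((Wi c : Matrix.specialUnitaryGroup n ℂ) : Matrix n n ℂ) - 1 with hYi
    set Y₀ : PBond P 0 → Matrix n n ℂ := fun b => ((W b : Matrix.specialUnitaryGroup n ℂ) : Matrix n n ℂ) - 1 with hY₀
    have hsi : 0 ≤ s i := hs0' i
    have h16i : 16 * (ℓ * s i) ≤ 1 := h16 i (by omega)
    have hNi : 2 * (ℓ * s i) < deltaSU n := hN i (by omega)
    have hℓ1 : (1 : ℝ) ≤ ℓ := by
      have : 1 ≤ (P.d + 2) * P.L := by have := P.L_pos; nlinarith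
      rw [hℓ]; exact_mod_cast this
    have hsi1 : s i ≤ 1 := by nlinarith
    have hiter : Averaging.iter (fun i => BlockAveraging.blockAvg (P := P) (j := i) (expMeanLogSU (n := n))) (i + 1) W =
        avgFun (expMeanLogSU (n := n)) Wi := iter_succ_eq _ i W
    refine ⟨fun c => ?_, fun p' => ?_⟩
    · -- (A) the bonds of the next average
      rw [hiter]
      have h1 := norm_avgFun_sub_one_sub_linAvg_le Wi hsi hA h16i hNi c
      have h2 : ‖linAvg Yi c‖ ≤ 3 * (ℓ * s i) := norm_linAvg_le Yi hsi (fun b => hA b) c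
      have h3 := norm_add_le (((avgFun (expMeanLogSU (n := n)) Wi c : Matrix.specialUnitaryGroup n ℂ) : Matrix n n ℂ) - 1 - linAvg Yi c) (linAvg Yi c)
      rw [sub_add_cancel] at h3
      have h4 := hsrec i (by omega)
      linarith
    · -- (B) the plaquettes of the next average
      rw [hiter]
      -- (M1) at level `i`
      have hM1 := norm_plaqHol_avgFun_sub_one_sub_fluxes_le hj Wi hsi hA h16i hNi p'
      -- each fine circulation of `Y_i` is `L^i (Q_i Y₀)(∂□)` up to `13 s_i² + E_i`
      have hterm : ∀ (r : Fin P.d → Fin P.L), ∀ s' ∈ Finset.range P.L, ∀ t ∈ Finset.range P.L,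
          ‖(Yi ⟨runSite (runSite (Site.blockSite p'.src r) p'.μ s') p'.ν t, p'.μ⟩ +
              Yi ⟨runSite (runSite (runSite (Site.blockSite p'.src r) p'.μ s') p'.ν t) p'.μ 1, p'.ν⟩ -
              Yi ⟨runSite (runSite (runSite (Site.blockSite p'.src r) p'.μ s') p'.ν t) p'.ν 1, p'.μ⟩ -
              Yi ⟨runSite (runSite (Site.blockSite p'.src r) p'.μ s') p'.ν t, p'.ν⟩) -
            ((P.L : ℝ) ^ i) • (bondAvgIter i Y₀ ⟨runSite (runSite (Site.blockSite p'.src r) p'.μ s') p'.ν t, p'.μ⟩ +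
              bondAvgIter i Y₀ ⟨runSite (runSite (runSite (Site.blockSite p'.src r) p'.μ s') p'.ν t) p'.μ 1, p'.ν⟩ -
              bondAvgIter i Y₀ ⟨runSite (runSite (runSite (Site.blockSite p'.src r) p'.μ s') p'.ν t) p'.ν 1, p'.μ⟩ -
              bondAvgIter i Y₀ ⟨runSite (runSite (Site.blockSite p'.src r) p'.μ s') p'.ν t, p'.ν⟩)‖ ≤ 13 * s i ^ 2 + E i := by
        intro r s' _ t _
        -- the fine plaquette `□ = (x; μ, ν)` with `x = blockSite y r + s' e_μ + t e_ν`
        set x : Site P i := runSite (runSite (Site.blockSite p'.src r) p'.μ s') p'.ν t with hx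
        have hq : ∀ μ : Fin P.d, runSite x μ 1 = x.shift μ := fun μ => by
          simp [runSite, Site.shift]
        let q : Plaq P i := ⟨x, p'.μ, p'.ν, p'.hμν⟩
        have hc := norm_plaqHol_sub_one_sub_circulation_le Wi hsi hsi1 hA q
        have hb := hB q
        simp only [q] at hc hb
        rw [hq p'.μ, hq p'.ν]
        -- `circ Y_i − L^iψ = (circ Y_i − Φ_i) + (Φ_i − L^iψ)`
        have e : (Yi ⟨x, p'.μ⟩ + Yi ⟨x.shift p'.μ, p'.ν⟩ - Yi ⟨x.shift p'.ν, p'.μ⟩ - Yi ⟨x, p'.ν⟩) -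
            ((P.L : ℝ) ^ i) • (bondAvgIter i Y₀ ⟨x, p'.μ⟩ + bondAvgIter i Y₀ ⟨x.shift p'.μ, p'.ν⟩ -
              bondAvgIter i Y₀ ⟨x.shift p'.ν, p'.μ⟩ - bondAvgIter i Y₀ ⟨x, p'.ν⟩) =
            -(((GaugeField.plaqHol Wi q : Matrix.specialUnitaryGroup n ℂ) : Matrix n n ℂ) - 1 -
              (Yi ⟨x, p'.μ⟩ + Yi ⟨x.shift p'.μ, p'.ν⟩ - Yi ⟨x.shift p'.ν, p'.μ⟩ - Yi ⟨x, p'.ν⟩)) +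
            (((GaugeField.plaqHol Wi q : Matrix.specialUnitaryGroup n ℂ) : Matrix n n ℂ) - 1 -
              ((P.L : ℝ) ^ i) • (bondAvgIter i Y₀ ⟨x, p'.μ⟩ + bondAvgIter i Y₀ ⟨x.shift p'.μ, p'.ν⟩ -
                bondAvgIter i Y₀ ⟨x.shift p'.ν, p'.μ⟩ - bondAvgIter i Y₀ ⟨x, p'.ν⟩)) := by abel
        rw [e]
        refine (norm_add_le _ _).trans (add_le_add ?_ hb)
        rw [norm_neg]
        exact hc
      -- the weighted triple sum of these differences
      have hsum := norm_weighted_sum_le (P := P) (fun r s' t =>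
          (Yi ⟨runSite (runSite (Site.blockSite p'.src r) p'.μ s') p'.ν t, p'.μ⟩ +
              Yi ⟨runSite (runSite (runSite (Site.blockSite p'.src r) p'.μ s') p'.ν t) p'.μ 1, p'.ν⟩ -
              Yi ⟨runSite (runSite (runSite (Site.blockSite p'.src r) p'.μ s') p'.ν t) p'.ν 1, p'.μ⟩ -
              Yi ⟨runSite (runSite (Site.blockSite p'.src r) p'.μ s') p'.ν t, p'.ν⟩) -
            ((P.L : ℝ) ^ i) • (bondAvgIter i Y₀ ⟨runSite (runSite (Site.blockSite p'.src r) p'.μ s') p'.ν t, p'.μ⟩ +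
              bondAvgIter i Y₀ ⟨runSite (runSite (runSite (Site.blockSite p'.src r) p'.μ s') p'.ν t) p'.μ 1, p'.ν⟩ -
              bondAvgIter i Y₀ ⟨runSite (runSite (runSite (Site.blockSite p'.src r) p'.μ s') p'.ν t) p'.ν 1, p'.μ⟩ -
              bondAvgIter i Y₀ ⟨runSite (runSite (Site.blockSite p'.src r) p'.μ s') p'.ν t, p'.ν⟩)) hterm
      -- the exact recursion of the linear term
      have hpsi := psi_succ (n := n) hj Y₀ p'
      -- names
      set Φ : Matrix n n ℂ := ((GaugeField.plaqHol (avgFun (expMeanLogSU (n := n)) Wi) p' : Matrix.specialUnitaryGroup n ℂ) :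
        Matrix n n ℂ) - 1 with hΦ
      set TC : Matrix n n ℂ := ((P.L : ℕ) : ℂ) • ((((P.L : ℝ) ^ (P.d + 1))⁻¹) • ∑ r : Fin P.d → Fin P.L, ∑ s' ∈ Finset.range P.L,
          ∑ t ∈ Finset.range P.L,
            (Yi ⟨runSite (runSite (Site.blockSite p'.src r) p'.μ s') p'.ν t, p'.μ⟩ +
              Yi ⟨runSite (runSite (runSite (Site.blockSite p'.src r) p'.μ s') p'.ν t) p'.μ 1, p'.ν⟩ -
              Yi ⟨runSite (runSite (runSite (Site.blockSite p'.src r) p'.μ s') p'.ν t) p'.ν 1, p'.μ⟩ -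
              Yi ⟨runSite (runSite (Site.blockSite p'.src r) p'.μ s') p'.ν t, p'.ν⟩)) with hTC
      set TΨ : Matrix n n ℂ := ((P.L : ℕ) : ℂ) • ((((P.L : ℝ) ^ (P.d + 1))⁻¹) • ∑ r : Fin P.d → Fin P.L, ∑ s' ∈ Finset.range P.L,
          ∑ t ∈ Finset.range P.L,
            ((P.L : ℝ) ^ i) • (bondAvgIter i Y₀ ⟨runSite (runSite (Site.blockSite p'.src r) p'.μ s') p'.ν t, p'.μ⟩ +
              bondAvgIter i Y₀ ⟨runSite (runSite (runSite (Site.blockSite p'.src r) p'.μ s') p'.ν t) p'.μ 1, p'.ν⟩ -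
              bondAvgIter i Y₀ ⟨runSite (runSite (runSite (Site.blockSite p'.src r) p'.μ s') p'.ν t) p'.ν 1, p'.μ⟩ -
              bondAvgIter i Y₀ ⟨runSite (runSite (Site.blockSite p'.src r) p'.μ s') p'.ν t, p'.ν⟩)) with hTΨ
      have hdiff : TC - TΨ = ((P.L : ℕ) : ℂ) • ((((P.L : ℝ) ^ (P.d + 1))⁻¹) • ∑ r : Fin P.d → Fin P.L, ∑ s' ∈ Finset.range P.L,
          ∑ t ∈ Finset.range P.L,
            ((Yi ⟨runSite (runSite (Site.blockSite p'.src r) p'.μ s') p'.ν t, p'.μ⟩ +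
                Yi ⟨runSite (runSite (runSite (Site.blockSite p'.src r) p'.μ s') p'.ν t) p'.μ 1, p'.ν⟩ -
                Yi ⟨runSite (runSite (runSite (Site.blockSite p'.src r) p'.μ s') p'.ν t) p'.ν 1, p'.μ⟩ -
                Yi ⟨runSite (runSite (Site.blockSite p'.src r) p'.μ s') p'.ν t, p'.ν⟩) -
              ((P.L : ℝ) ^ i) • (bondAvgIter i Y₀ ⟨runSite (runSite (Site.blockSite p'.src r) p'.μ s') p'.ν t, p'.μ⟩ +
                bondAvgIter i Y₀ ⟨runSite (runSite (runSite (Site.blockSite p'.src r) p'.μ s') p'.ν t) p'.μ 1, p'.ν⟩ -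
                bondAvgIter i Y₀ ⟨runSite (runSite (runSite (Site.blockSite p'.src r) p'.μ s') p'.ν t) p'.ν 1, p'.μ⟩ -
                bondAvgIter i Y₀ ⟨runSite (runSite (Site.blockSite p'.src r) p'.μ s') p'.ν t, p'.ν⟩))) := by
        rw [hTC, hTΨ, ← smul_sub, ← smul_sub]
        simp only [Finset.sum_sub_distrib]
      have hΦTC : ‖Φ - TC‖ ≤ 1377 * (ℓ * s i) ^ 2 := hM1
      have hTCΨ : ‖TC - TΨ‖ ≤ (P.L : ℝ) ^ 2 * (13 * s i ^ 2 + E i) := by rw [hdiff]; exact hsum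
      rw [hpsi]
      have e : Φ - TΨ = (Φ - TC) + (TC - TΨ) := by abel
      have hE := hErec i (by omega)
      calc ‖Φ - TΨ‖ = ‖(Φ - TC) + (TC - TΨ)‖ := by rw [e]
        _ ≤ ‖Φ - TC‖ + ‖TC - TΨ‖ := norm_add_le _ _
        _ ≤ 1377 * (ℓ * s i) ^ 2 + (P.L : ℝ) ^ 2 * (13 * s i ^ 2 + E i) := add_le_add hΦTC hTCΨ
        _ ≤ E (i + 1) := by nlinarith [hE]


/-- ★★ **GEOMETRIC MAJORANTS** (the form a consumer wants): with `s_i := (4ℓ)^i·s₀` and `E_i := 100·(4ℓ)^{2i}·s₀²` the recursion inequalities of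
`iter_plaqHol_flux_linear` hold as soon as `81ℓ·(4ℓ)^j·s₀ ≤ 1` (then `81(ℓs_i)² ≤ ℓs_i`, and `100·16ℓ² ≥ 100L² + 1390ℓ²`), so: for `‖W_b − 1‖ ≤ s₀` on every bond,
`81ℓ(4ℓ)^j s₀ ≤ 1`, `2ℓ(4ℓ)^j s₀ < δ_N`, `j ≤ m + K`:  (A) `‖Ū^{(j)}[W](c) − 1‖ ≤ (4ℓ)^j s₀` and
(B) `‖(Ū^{(j)}[W](∂p) − 1) − L^j·(Q_j(W−1))(∂p)‖ ≤ 100·(4ℓ)^{2j}·s₀²` — second order in `s₀` with the explicit geometric loss `(4ℓ)^{2j}`.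
[cite: Balaban1985Averaging, Prop. 1 (51) p.26 and Prop. 4 (134)-(135) p.38; Balaban1984PropagatorsI, (1.18) p.20] -/
theorem iter_plaqHol_flux_linear_geometric {j : ℕ} (hj : j ≤ P.m + P.K) (W : GaugeField P 0 (Matrix.specialUnitaryGroup n ℂ)) {s₀ : ℝ}
    (hs₀ : 0 ≤ s₀) (hW : ∀ b, ‖((W b : Matrix.specialUnitaryGroup n ℂ) : Matrix n n ℂ) - 1‖ ≤ s₀)
    (h81 : 81 * (((P.d + 2) * P.L : ℕ) : ℝ) * ((4 * (((P.d + 2) * P.L : ℕ) : ℝ)) ^ j * s₀) ≤ 1)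
    (hN : 2 * ((((P.d + 2) * P.L : ℕ) : ℝ) * ((4 * (((P.d + 2) * P.L : ℕ) : ℝ)) ^ j * s₀)) < deltaSU n) :
    (∀ c : PBond P j, ‖((Averaging.iter (fun i => BlockAveraging.blockAvg (P := P) (j := i) (expMeanLogSU (n := n))) j W c :
        Matrix.specialUnitaryGroup n ℂ) : Matrix n n ℂ) - 1‖ ≤ (4 * (((P.d + 2) * P.L : ℕ) : ℝ)) ^ j * s₀) ∧
    ∀ p : Plaq P j,
      ‖((GaugeField.plaqHol (Averaging.iter (fun i => BlockAveraging.blockAvg (P := P) (j := i) (expMeanLogSU (n := n))) j W) p :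
            Matrix.specialUnitaryGroup n ℂ) : Matrix n n ℂ) - 1 -
          ((P.L : ℝ) ^ j) • (bondAvgIter j (fun b => ((W b : Matrix.specialUnitaryGroup n ℂ) : Matrix n n ℂ) - 1) ⟨p.src, p.μ⟩ +
            bondAvgIter j (fun b => ((W b : Matrix.specialUnitaryGroup n ℂ) : Matrix n n ℂ) - 1) ⟨p.src.shift p.μ, p.ν⟩ -
            bondAvgIter j (fun b => ((W b : Matrix.specialUnitaryGroup n ℂ) : Matrix n n ℂ) - 1) ⟨p.src.shift p.ν, p.μ⟩ -
            bondAvgIter j (fun b => ((W b : Matrix.specialUnitaryGroup n ℂ) : Matrix n n ℂ) - 1) ⟨p.src, p.ν⟩)‖ ≤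
        100 * ((4 * (((P.d + 2) * P.L : ℕ) : ℝ)) ^ j) ^ 2 * s₀ ^ 2 := by
  set ℓ : ℝ := (((P.d + 2) * P.L : ℕ) : ℝ) with hℓ
  have hℓ1 : (1 : ℝ) ≤ ℓ := by
    have : 1 ≤ (P.d + 2) * P.L := by have := P.L_pos; nlinarith
    rw [hℓ]; exact_mod_cast this
  have hLℓ : (P.L : ℝ) ≤ ℓ := by
    have : P.L ≤ (P.d + 2) * P.L := Nat.le_mul_of_pos_left _ (by omega)
    rw [hℓ]; exact_mod_cast this
  have hL0 : (0 : ℝ) ≤ P.L := Nat.cast_nonneg _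
  have h4ℓ1 : (1 : ℝ) ≤ 4 * ℓ := by linarith
  -- the majorants
  set s : ℕ → ℝ := fun i => (4 * ℓ) ^ i * s₀ with hs
  set E : ℕ → ℝ := fun i => 100 * ((4 * ℓ) ^ i) ^ 2 * s₀ ^ 2 with hE
  have hs_nonneg : ∀ i, 0 ≤ s i := fun i => by positivity
  have hs_mono : ∀ i, i ≤ j → s i ≤ s j := fun i hi =>
    mul_le_mul_of_nonneg_right (pow_le_pow_right₀ h4ℓ1 hi) hs₀
  -- `ℓ s_i ≤ 1/81` for `i ≤ j`
  have hℓs : ∀ i, i ≤ j → 81 * (ℓ * s i) ≤ 1 := fun i hi => by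
    have := hs_mono i hi
    calc 81 * (ℓ * s i) ≤ 81 * (ℓ * s j) := by gcongr
      _ = 81 * ℓ * ((4 * ℓ) ^ j * s₀) := by rw [hs]; ring
      _ ≤ 1 := h81
  have hres := iter_plaqHol_flux_linear (n := n) j hj W s E hs_nonneg (by simpa [hs] using hW)
    (fun i hi => by linarith [hℓs i hi, mul_nonneg (zero_le_one.trans hℓ1) (hs_nonneg i)])
    (fun i hi => by
      have := hs_mono i hi.le
      calc 2 * (ℓ * s i) ≤ 2 * (ℓ * s j) := by gcongr
        _ = 2 * (ℓ * ((4 * ℓ) ^ j * s₀)) := by rw [hs]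
        _ < deltaSU n := hN)
    (fun i hi => by
      -- `3ℓs + 81(ℓs)² ≤ 3ℓs + ℓs = 4ℓ s = s_{i+1}`
      have h1 : 81 * (ℓ * s i) ^ 2 ≤ ℓ * s i := by
        have hx : 0 ≤ ℓ * s i := mul_nonneg (zero_le_one.trans hℓ1) (hs_nonneg i)
        nlinarith [hℓs i hi.le]
      have h2 : s (i + 1) = 4 * ℓ * s i := by simp only [hs]; ring
      rw [h2]; linarith)
    (by simp only [hs, hE, pow_zero, one_mul, one_pow]; nlinarith [sq_nonneg s₀])
    (fun i hi => by
      -- `L²E_i + 1377ℓ²s_i² + 13L²s_i² ≤ (100L² + 1390ℓ²)·(4ℓ)^{2i}s₀² ≤ 1600ℓ²·(4ℓ)^{2i}s₀² = E_{i+1}`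
      have hL2 : (P.L : ℝ) ^ 2 ≤ ℓ ^ 2 := pow_le_pow_left₀ hL0 hLℓ 2
      have hsi : s i ^ 2 = ((4 * ℓ) ^ i) ^ 2 * s₀ ^ 2 := by simp only [hs]; ring
      have hEi : E i = 100 * ((4 * ℓ) ^ i) ^ 2 * s₀ ^ 2 := rfl
      have hEi1 : E (i + 1) = 1600 * ℓ ^ 2 * (((4 * ℓ) ^ i) ^ 2 * s₀ ^ 2) := by
        simp only [hE, pow_succ]; ring
      have hX : 0 ≤ ((4 * ℓ) ^ i) ^ 2 * s₀ ^ 2 := by positivity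
      rw [hEi, hEi1, hsi]
      nlinarith [mul_le_mul_of_nonneg_right hL2 hX, mul_nonneg (mul_nonneg (by norm_num : (0:ℝ) ≤ 1377) (sq_nonneg ℓ)) hX])
  simpa [hs, hE] using hres

end Main

/-! ## §3 The linear term in closed form: the uniform mean of the fine circulations over the translated-square family -/

section ClosedForm

omit [Fintype n] [DecidableEq n] [Nonempty n] in
/-- ★ **THE WEIGHTS `w^{(k)}` IN CLOSED FORM** ([Balaban1984PropagatorsI] (1.18) one-stroke formula + abelian lattice Stokes): for every bond
field `A` on `T^{(0)}` and every plaquette `p = (y; μ, ν)` of `T^{(k)}` (standing range `k ≤ m + K`),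
`L^k·((Q_kA)(c₁) + (Q_kA)(c₂) − (Q_kA)(c₃) − (Q_kA)(c₄)) = (L^{kd})⁻¹·Σ_{x ∈ B^k(y)} Σ_{s<L^k} Σ_{t<L^k} A(∂□(x + s e_μ + t e_ν))` — `(L^k)²` times
the UNIFORM MEAN of the fine circulations over the `L^{kd}·L^{2k}` plaquettes of the translated-square family of `p` (each fine plaquette counted
with the tent multiplicity of its position). [cite: Balaban1984PropagatorsI, (1.9)-(1.11) p.19 and (1.18) p.20] -/
theorem circ_bondAvgIter_eq_sum {k : ℕ} (hk : k ≤ P.m + P.K) (A : VecField P 0 (Matrix n n ℂ)) (p : Plaq P k) :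
    ((P.L : ℝ) ^ k) • (bondAvgIter k A ⟨p.src, p.μ⟩ + bondAvgIter k A ⟨p.src.shift p.μ, p.ν⟩ -
        bondAvgIter k A ⟨p.src.shift p.ν, p.μ⟩ - bondAvgIter k A ⟨p.src, p.ν⟩) =
      ((((P.L : ℝ) ^ P.d) ^ k)⁻¹) • ∑ x ∈ iterBlock k p.src, ∑ s ∈ Finset.range (P.L ^ k), ∑ t ∈ Finset.range (P.L ^ k),
        (A ⟨runSite (runSite x p.μ s) p.ν t, p.μ⟩ + A ⟨runSite (runSite (runSite x p.μ s) p.ν t) p.μ 1, p.ν⟩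
          - A ⟨runSite (runSite (runSite x p.μ s) p.ν t) p.ν 1, p.μ⟩ - A ⟨runSite (runSite x p.μ s) p.ν t, p.ν⟩) := by
  have hshift : ∀ μ : Fin P.d, p.src.shift μ = runSite p.src μ 1 := fun μ => by simp [runSite, Site.shift]
  rw [hshift p.μ, hshift p.ν, bondAvgIter_eq_blockSum k hk A ⟨p.src, p.μ⟩, bondAvgIter_eq_blockSum k hk A ⟨runSite p.src p.μ 1, p.ν⟩,
    bondAvgIter_eq_blockSum k hk A ⟨runSite p.src p.ν 1, p.μ⟩, bondAvgIter_eq_blockSum k hk A ⟨p.src, p.ν⟩]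
  simp only
  rw [sum_iterBlock_runSite hk _ p.src p.μ 1, sum_iterBlock_runSite hk _ p.src p.ν 1, one_mul,
    ← smul_add, ← smul_sub, ← smul_sub, ← Finset.sum_add_distrib, ← Finset.sum_sub_distrib, ← Finset.sum_sub_distrib]
  simp_rw [rect_stokes A _ p.μ p.ν (P.L ^ k) (P.L ^ k)]
  rw [smul_smul]
  congr 1
  have hL : (P.L : ℝ) ≠ 0 := Nat.cast_ne_zero.mpr P.L_pos.ne'
  rw [← pow_mul, ← pow_mul, show (P.d + 1) * k = P.d * k + k by ring, pow_add]
  field_simp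

end ClosedForm


end Summit.QuantumFields.YangMills.Theorems.CovariantDischargeAvgPlaqFluxLinearIter

end
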